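import Mathlib
import Summits.Ventures.DiscreteObjects.Mahler.PalindromicQuartic

/-!
# The degree-4 census row below `1.3248` in the kernel (venture `DiscreteObjects`, target L)

Cell `pub-namedobj`, seat `pub-namedobj-mahler` (gen 10). Framing: lottery ticket; floor = certified
bounds/negative ranges.

**Theorem** (`degreeCensus_four`): `DegreeCensus 4 1.3248 []` — no irreducible integer polynomial of
degree `4` has Mahler measure in `(1, 1.3248)` (the smallest degree-4 measure in Boyd's / Mossinghoff's
tables is `M(x⁴ - x³ - 1) = 1.3803`).  Zero compute:
* a NONRECIPROCAL irreducible quartic has `M = θ₀` or `M > 1.3248` (Smyth's theorem with isolation), and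
  `M = θ₀` forces degree `3k` (equality case) — impossible;
* an antireciprocal one vanishes at `1`; a RECIPROCAL one is `±m` with `m` monic palindromic, handled by
  `palindromic_quartic_measure`.
With `degreeCensus_one/two/three` (gen 10, `LowDegreeCensus`) and the odd-degree rows (`OddDegreeCensus`):
every irreducible integer polynomial of degree `≤ 5` with `1 < M < 1.3248` is one of the eight Smyth
trinomials of degree `3`.
-/

namespace Summit.Ventures.DiscreteObjects.Mahler

open Polynomial

/-- **Degree-4 census row below `1.3248`:** `DegreeCensus 4 1.3248 []` — no irreducible integer polynomial
of degree `4` has Mahler measure in `(1, 1.3248)`. -/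
theorem degreeCensus_four : DegreeCensus 4 (13248 / 10000) [] := by
  intro p hdeg hirr h1 h2
  exfalso
  have h0 : p.coeff 0 ≠ 0 := coeff_zero_ne_zero_of_irreducible hirr (by omega)
  have hnoroot : ∀ t : ℤ, p.eval t ≠ 0 := by
    intro t ht
    have hdvd : X - C t ∣ p := dvd_iff_isRoot.mpr ht
    have hass : Associated (X - C t) p := (irreducible_X_sub_C t).associated_of_dvd hirr hdvd
    have h1 := natDegree_eq_of_degree_eq (degree_eq_degree_of_associated hass)
    rw [natDegree_X_sub_C] at h1
    omega
  by_cases hrec : p.reverse = p ∨ p.reverse = -p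
  · rcases hrec with hrev | hrev
    · -- reciprocal: normalise to monic
      have hlc : (|p.leadingCoeff| : ℝ) ≤ intMahlerMeasure p := abs_leadingCoeff_le_intMahlerMeasure p
      have hlc1 : p.leadingCoeff = 1 ∨ p.leadingCoeff = -1 := by
        have hne : p.leadingCoeff ≠ 0 := leadingCoeff_ne_zero.mpr hirr.ne_zero
        have hle : |p.leadingCoeff| ≤ 1 := by
          by_contra h
          push Not at h
          have : (2 : ℝ) ≤ (|p.leadingCoeff| : ℝ) := by
            have : (2 : ℤ) ≤ |p.leadingCoeff| := h
            exact_mod_cast this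
          linarith
        rcases abs_le.mp hle with ⟨h1', h2'⟩
        omega
      obtain ⟨hmonic, hpm, hMm, hdegm, hirrm⟩ := monic_normalisation hlc1
      have hrevm : (C p.leadingCoeff * p).reverse = C p.leadingCoeff * p := by
        rw [reverse_mul_of_domain, reverse_C, hrev]
      rw [← hMm] at h1 h2
      rw [hdeg] at hdegm
      exact palindromic_quartic_measure (hirrm hirr) hdegm hmonic hrevm h1 h2
    · exact hnoroot 1 (eval_one_eq_zero_of_reverse_eq_neg hrev)
  · -- nonreciprocal: Smyth with isolation and the equality case
    push Not at hrec
    have hMθ := intMahlerMeasure_eq_smythTheta_of_lt hirr h0 hrec.1 hrec.2 h2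
    obtain ⟨k, hk, a, ha, s, hs, hform⟩ :=
      (intMahlerMeasure_eq_smythTheta_iff_eq hirr h0 hrec.1 hrec.2).mp hMθ
    have ha0 : a ≠ 0 := by rcases ha with h | h <;> simp [h]
    have hs0 : s ≠ 0 := by rcases hs with h | h <;> simp [h]
    have hdegP : (1 - X ^ (2 * k) + C a * X ^ (3 * k) : ℤ[X]).natDegree = 3 * k := by
      have : (1 - X ^ (2 * k) + C a * X ^ (3 * k) : ℤ[X]) = trinomial 0 (2 * k) (3 * k) 1 (-1) a := by
        rw [trinomial_def]; simp; ring
      rw [this]; exact trinomial_natDegree (by omega) (by omega) ha0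
    have hdegQ : (1 - C a * X ^ k + C a * X ^ (3 * k) : ℤ[X]).natDegree = 3 * k := by
      have : (1 - C a * X ^ k + C a * X ^ (3 * k) : ℤ[X]) = trinomial 0 k (3 * k) 1 (-a) a := by
        rw [trinomial_def]; simp; ring
      rw [this]; exact trinomial_natDegree (by omega) (by omega) ha0
    rcases hform with h | h
    · have := congrArg natDegree h
      rw [hdeg, natDegree_C_mul hs0, hdegP] at this
      omega
    · have := congrArg natDegree h
      rw [hdeg, natDegree_C_mul hs0, hdegQ] at this
      omega

end Summit.Ventures.DiscreteObjects.Mahler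

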